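import Summits.HodgeConjecture.HodgeConjecture.Theorems.MarkmanPartnerTransportPicardThreeK3SquaresAlgebraicLocusSpreadSection

/-!
# Route MarkmanPartnerTransport · crux `PicardThreeK3Squares` (stmt-HodgeConjecture-19652) —
# «VERY-GENERAL SPREAD»: a class algebraic on a RESIDUAL set of fibres is algebraic on every fibre, and
# the Hodge conjecture for the VERY GENERAL fibre makes a global Hodge class algebraic on the SPECIAL ones

Sequel to `…AlgebraicLocusSpread` / `…AlgebraicLocusSpreadSection` (prover g7: stub F3 of line
`cm-anchor-spread`, spread from a non-empty OPEN set resp. along a DOMINANT morphism). The Baire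
upgrade: the hypothesis "algebraic on the fibres over a non-empty open set" is weakened to "algebraic on
the fibres over a RESIDUAL (comeagre) subset of `B(ℂ)`", i.e. — in the printed idiom — "algebraic at a
very general point". This is the form in which the input actually arises on a Noether–Lefschetz
stratification: the Hodge conjecture, or the existence of a cycle, is typically known or assumed for
the VERY GENERAL member of a family (off a countable union of proper closed subvarieties — e.g. off the
Noether–Lefschetz loci where the Picard number jumps), and one wants the class on a SPECIAL fibre.

* `forall_mem_algebraicClasses_of_residual` — for a smooth projective family `g : 𝒳 → B` with
  quasi-projective total space over a smooth irreducible quasi-projective base and a global class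
  `W ∈ H²ᵖ(𝒳(ℂ); ℂ)`: if `W|_{𝒳_b}` is algebraic for a residual set of `b ∈ B(ℂ)` then it is algebraic
  for EVERY `b`. Proof: the algebraicity locus is `⋃ⱼ Wⱼ(ℂ)`, `Wⱼ ⊆ B` Zariski-closed
  (`charlesSchnell_algebraicityLocus_iUnion_closed_holds`, Charles–Schnell Prop. 11.3.11); a proper
  `Wⱼ` has `Wⱼ(ℂ)` closed with empty interior (`ComplexPoints.interior_setOf_pt_mem_eq_empty`, GAGA),
  so were one fibre class not algebraic the locus would be meagre — impossible for a residual subset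
  of the non-empty Baire space `B(ℂ)` (`ComplexPoints.baireSpace`, Mathlib
  `not_isMeagre_of_mem_residual`).
* `forall_mem_algebraicClasses_of_forall_pt_not_mem` — the same with the residual set displayed as
  "off countably many proper Zariski-closed `Cᵢ ⊊ B`".
* `forall_mem_algebraicClasses_of_residual_hodgeConjectureFor` — **if the very general fibre
  satisfies the Hodge conjecture (`HodgeConjectureFor n 𝒳_b` for residual-many `b`) and `W|_{𝒳_b}` is
  a rational `(p,p)`-class there, then `W|_{𝒳_b}` is algebraic on EVERY fibre** — including the special
  (Noether–Lefschetz) fibres, where nothing is assumed.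
* `…_of_section` — the same three for a CONTINUOUS SECTION of the espace étalé `FiberClass g (2p)` of
  `R²ᵖ g_* ℂ` (a flat family of fibre classes), unconditional: Deligne's theorem of the fixed part is
  the tree's `deligne1968_invariantClass_fromTotalSpace_holds`, uniqueness of flat continuation is
  `section_eq_globalSection_of_eq`.

The consumer on the crux (NS-absorption and "HC for the very general fibre of a family through
`S ⊗ S` ⟹ HC⁴(`S ⊗ S`)") is the sequel `…PicardThreeK3SquaresNSAbsorption`. No definition, no sorry,
no named-fact hypothesis. Prover seat hodge-nonav-19652-p1 (gen 18), `--supports stmt-HodgeConjecture-19652`.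
Nothing here proves the crux or the Hodge conjecture.

References: Voisin, *Hodge Theory II* (2003), §3.3.1 ("very general point"), §5.3.1, §7.3.2 and
Thm. 4.18; Charles–Schnell, *Notes on absolute Hodge classes* (2014), Prop. 11.3.11; Serre, GAGA
(1956) §2 n°7 Prop. 5; van Geemen–Schütt, Forum Math. Sigma 13 (2025) e2, §3.4 (the RM loci and their
Noether–Lefschetz sub-loci).
-/

set_option linter.dupNamespace false

noncomputable section

namespace Summit.HodgeConjecture.HodgeConjecture.Theorems.MarkmanPartnerTransport.VeryGeneralSpread

open CategoryTheory MonoidalCategory CartesianMonoidalCategory AlgebraicGeometry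
open Literature.AlgebraicGeometry Literature.AlgebraicGeometry.Motives Literature.AlgebraicGeometry.HodgeTheory
open Literature.AlgebraicGeometry.Surfaces
open Literature.AlgebraicTopology.SingularHomology
open Summit.HodgeConjecture.HodgeConjecture.Theorems.MarkmanPartnerTransport.AlgebraicLocusSpread

variable {𝒳 B : SchemeOver ℂ}

/-! ### Spread of algebraicity from a residual (comeagre) set of fibres -/

/-- **Residual-to-everywhere spread of algebraicity.** For a smooth projective family `g : 𝒳 → B`
with quasi-projective total space over a smooth irreducible quasi-projective base and a global class
`W ∈ H²ᵖ(𝒳(ℂ); ℂ)`: if `W|_{𝒳_b}` is algebraic for a RESIDUAL set of `b ∈ B(ℂ)` (analytic topology;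
e.g. for every `b` off a countable union of closed nowhere-dense subsets — "for very general `b`"),
then it is algebraic for every `b ∈ B(ℂ)`. The algebraicity locus is `⋃ⱼ Wⱼ(ℂ)` for countably many
Zariski-closed `Wⱼ ⊆ B` (`charlesSchnell_algebraicityLocus_iUnion_closed_holds`); were some fibre class
not algebraic, every `Wⱼ` would be proper, so every `Wⱼ(ℂ)` closed with empty interior
(`ComplexPoints.interior_setOf_pt_mem_eq_empty`), the locus meagre, and a meagre set is not residual
in the non-empty Baire space `B(ℂ)` (`ComplexPoints.baireSpace`).
[cite: CharlesSchnell2014Notes, Prop. 11.3.11 (proof)] [cite: VoisinHodgeII2003, §3.3.1 and §7.3.2] -/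
theorem forall_mem_algebraicClasses_of_residual (g : 𝒳 ⟶ B) {n p : ℕ}
    (hg : IsSmoothProjectiveFamily g n) (h𝒳 : IsQuasiProjectiveOver 𝒳) (hB : IsQuasiProjectiveOver B)
    (hBsm : AlgebraicGeometry.Smooth B.hom) [IrreducibleSpace B.left] (W : complexBetti 𝒳 (2 * p))
    (hres : ∀ᶠ b in residual (ComplexPoints B),
      complexBetti.map (fiberι g b) (2 * p) W ∈ algebraicClasses (fiberOver g b) p)
    (b : ComplexPoints B) :
    complexBetti.map (fiberι g b) (2 * p) W ∈ algebraicClasses (fiberOver g b) p := by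
  obtain ⟨Z, hZc, hloc⟩ := charlesSchnell_algebraicityLocus_iUnion_closed_holds g n p h𝒳 hB hBsm hg W
  haveI : LocallyOfFiniteType B.hom := locallyOfFiniteType_of_isQuasiProjectiveOver hB
  haveI : IsSeparated B.hom := by
    obtain ⟨P', j', hP', hj'⟩ := hB
    haveI : IsProper P'.hom := hP'.isProper
    rw [show B.hom = j'.left ≫ P'.hom from (Over.w j').symm]
    infer_instance
  haveI : BaireSpace (ComplexPoints B) := ComplexPoints.baireSpace B
  haveI : Nonempty (ComplexPoints B) := ⟨b⟩
  by_contra hb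
  have hne : ∀ j, Z j ≠ Set.univ := by
    intro j hj
    apply hb
    have hmem : b ∈ ⋃ j, {t : ComplexPoints B | t.pt ∈ Z j} :=
      Set.mem_iUnion.2 ⟨j, by simp only [Set.mem_setOf_eq, hj, Set.mem_univ]⟩
    rw [← hloc] at hmem
    exact hmem
  -- each `Z j(ℂ)` is closed with empty interior, hence nowhere dense
  have hnd : ∀ j, IsNowhereDense {t : ComplexPoints B | t.pt ∈ Z j} := by
    intro j
    have hcl : IsClosed {t : ComplexPoints B | t.pt ∈ Z j} := by
      have hop : IsOpen {t : ComplexPoints B | t.pt ∈ ((⟨(Z j)ᶜ, (hZc j).isOpen_compl⟩ : B.left.Opens) :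
          Set B.left)} :=
        AlgPoints.isOpen_setOf_pt_mem (X := B) (L := ℂ) ⟨(Z j)ᶜ, (hZc j).isOpen_compl⟩
      have heq : {t : ComplexPoints B | t.pt ∈ Z j} =
          {t : ComplexPoints B | t.pt ∈ ((⟨(Z j)ᶜ, (hZc j).isOpen_compl⟩ : B.left.Opens) : Set B.left)}ᶜ := by
        ext t
        simp
      rw [heq]
      exact hop.isClosed_compl
    rw [hcl.isNowhereDense_iff]
    exact ComplexPoints.interior_setOf_pt_mem_eq_empty (hZc j) (hne j)
  have hmeagre : IsMeagre {t : ComplexPoints B |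
      complexBetti.map (fiberι g t) (2 * p) W ∈ algebraicClasses (fiberOver g t) p} := by
    rw [hloc]
    exact isMeagre_iUnion fun j => (hnd j).isMeagre
  exact not_isMeagre_of_mem_residual hres hmeagre

/-- **Very-general-to-everywhere spread** (the printed idiom "algebraic at a very general point, hence
everywhere"): as `forall_mem_algebraicClasses_of_residual`, with the residual set displayed as the
complement of countably many PROPER Zariski-closed subsets `Cᵢ ⊊ B` — if `W|_{𝒳_b}` is algebraic for
every `b ∈ B(ℂ)` lying in no `Cᵢ`, it is algebraic for every `b`. (The complex points off the `Cᵢ` are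
a countable intersection of dense open subsets of `B(ℂ)`: `ComplexPoints.dense_setOf_pt_not_mem`.)
[cite: VoisinHodgeII2003, §3.3.1 and §7.3.2] [cite: CharlesSchnell2014Notes, Prop. 11.3.11] -/
theorem forall_mem_algebraicClasses_of_forall_pt_not_mem (g : 𝒳 ⟶ B) {n p : ℕ}
    (hg : IsSmoothProjectiveFamily g n) (h𝒳 : IsQuasiProjectiveOver 𝒳) (hB : IsQuasiProjectiveOver B)
    (hBsm : AlgebraicGeometry.Smooth B.hom) [IrreducibleSpace B.left] (W : complexBetti 𝒳 (2 * p))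
    {ι : Type*} [Countable ι] {C : ι → Set B.left} (hC : ∀ i, IsClosed (C i))
    (hCne : ∀ i, C i ≠ Set.univ)
    (halg : ∀ b : ComplexPoints B, (∀ i, b.pt ∉ C i) →
      complexBetti.map (fiberι g b) (2 * p) W ∈ algebraicClasses (fiberOver g b) p)
    (b : ComplexPoints B) :
    complexBetti.map (fiberι g b) (2 * p) W ∈ algebraicClasses (fiberOver g b) p := by
  haveI : LocallyOfFiniteType B.hom := locallyOfFiniteType_of_isQuasiProjectiveOver hB
  refine forall_mem_algebraicClasses_of_residual g hg h𝒳 hB hBsm W ?_ b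
  have hopen : ∀ i, IsOpen {P : ComplexPoints B | P.pt ∉ C i} := fun i =>
    AlgPoints.isOpen_setOf_pt_mem (X := B) (L := ℂ) ⟨(C i)ᶜ, (hC i).isOpen_compl⟩
  have hdense : ∀ i, Dense {P : ComplexPoints B | P.pt ∉ C i} := fun i =>
    ComplexPoints.dense_setOf_pt_not_mem (hC i) (hCne i)
  have hmem : (⋂ i, {P : ComplexPoints B | P.pt ∉ C i}) ∈ residual (ComplexPoints B) :=
    (countable_iInter_mem).2 fun i => residual_of_dense_open (hopen i) (hdense i)
  refine Filter.mem_of_superset hmem ?_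
  intro P hP
  exact halg P (by simpa using hP)

/-- **The Hodge conjecture for the very general fibre makes a global Hodge class algebraic on EVERY
fibre.** Same family; if for a residual set of `b ∈ B(ℂ)` the fibre `𝒳_b` satisfies the Hodge
conjecture (`HodgeConjectureFor n 𝒳_b`) and `W|_{𝒳_b}` is a rational class of Hodge type `(p,p)`, then
`W|_{𝒳_b}` is algebraic for every `b ∈ B(ℂ)` — in particular on the SPECIAL fibres (Noether–Lefschetz
points), where the Hodge conjecture is not assumed. [cite: VoisinHodgeII2003, §7.3.2]
[cite: CharlesSchnell2014Notes, Prop. 11.3.11] -/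
theorem forall_mem_algebraicClasses_of_residual_hodgeConjectureFor (g : 𝒳 ⟶ B) {n p : ℕ}
    (hg : IsSmoothProjectiveFamily g n) (h𝒳 : IsQuasiProjectiveOver 𝒳) (hB : IsQuasiProjectiveOver B)
    (hBsm : AlgebraicGeometry.Smooth B.hom) [IrreducibleSpace B.left] (W : complexBetti 𝒳 (2 * p))
    (hHC : ∀ᶠ b in residual (ComplexPoints B), HodgeConjectureFor n (fiberOver g b))
    (hrat : ∀ᶠ b in residual (ComplexPoints B), IsRationalClass (complexBetti.map (fiberι g b) (2 * p) W))
    (htyp : ∀ᶠ b in residual (ComplexPoints B),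
      IsOfHodgeType n (fiberOver g b) (2 * p) p p (complexBetti.map (fiberι g b) (2 * p) W))
    (b : ComplexPoints B) :
    complexBetti.map (fiberι g b) (2 * p) W ∈ algebraicClasses (fiberOver g b) p := by
  refine forall_mem_algebraicClasses_of_residual g hg h𝒳 hB hBsm W ?_ b
  filter_upwards [hHC, hrat, htyp] with b' hHC' hrat' htyp'
  exact hHC'.2 p _ hrat' htyp'

/-! ### Flat-section forms (unconditional: Voisin II Thm. 4.18 is the tree's
`deligne1968_invariantClass_fromTotalSpace_holds`) -/

/-- **A flat section algebraic on a residual set of fibres is algebraic everywhere.** Setting: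
`g : 𝒳 → B` smooth projective family, `𝒳`, `B` quasi-projective, `B` smooth irreducible; `σ` a
continuous section of the espace étalé `FiberClass g (2p)` of `R²ᵖ g_* ℂ`. If `(σ b).cls` is algebraic
for a residual set of `b ∈ B(ℂ)`, it is algebraic for all `b`: Deligne's theorem of the fixed part
(`deligne1968_invariantClass_fromTotalSpace_holds`) and uniqueness of flat continuation
(`section_eq_globalSection_of_eq`) write `σ = (·, β|_·)` for a global class `β`, to which
`forall_mem_algebraicClasses_of_residual` applies. [cite: VoisinHodgeII2003, Thm. 4.18 and §7.3.2]
[cite: CharlesSchnell2014Notes, Prop. 11.3.11] -/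
theorem forall_cls_mem_algebraicClasses_of_residual_of_section (g : 𝒳 ⟶ B) {n p : ℕ}
    (hg : IsSmoothProjectiveFamily g n) (h𝒳 : IsQuasiProjectiveOver 𝒳) (hB : IsQuasiProjectiveOver B)
    (hBsm : AlgebraicGeometry.Smooth B.hom) [IrreducibleSpace B.left]
    (σ : ComplexPoints B → FiberClass g (2 * p)) (hσ : Continuous σ) (hpt : ∀ b, (σ b).pt = b)
    (hres : ∀ᶠ b in residual (ComplexPoints B), (σ b).clsAt (hpt b) ∈ algebraicClasses (fiberOver g b) p)
    (b : ComplexPoints B) :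
    (σ b).clsAt (hpt b) ∈ algebraicClasses (fiberOver g b) p := by
  obtain ⟨β, hβ⟩ := deligne1968_invariantClass_fromTotalSpace_holds 𝒳 B g n hg h𝒳 hB hBsm (2 * p) σ hσ hpt b
  have hall : ∀ b', σ b' = globalSection g (2 * p) β b' :=
    section_eq_globalSection_of_eq g (2 * p) hg hB hBsm σ hσ hpt β hβ
  have hcls : ∀ b', (σ b').clsAt (hpt b') = complexBetti.map (fiberι g b') (2 * p) β := fun b' =>
    cls_eq_map_of_section_eq_globalSection g (2 * p) σ β (hpt b') (hall b')
  rw [hcls]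
  refine forall_mem_algebraicClasses_of_residual g hg h𝒳 hB hBsm β ?_ b
  filter_upwards [hres] with b' hb'
  exact (hcls b') ▸ hb'

/-- **Flat-section form of "HC for the very general fibre ⟹ the class is algebraic on every fibre"**:
a continuous section `σ` of `FiberClass g (2p)` whose values are rational `(p,p)`-classes on a residual
set of fibres satisfying the Hodge conjecture has algebraic values on EVERY fibre.
[cite: VoisinHodgeII2003, Thm. 4.18 and §7.3.2] [cite: CharlesSchnell2014Notes, Prop. 11.3.11] -/
theorem forall_cls_mem_algebraicClasses_of_residual_hodgeConjectureFor_of_section (g : 𝒳 ⟶ B)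
    {n p : ℕ} (hg : IsSmoothProjectiveFamily g n) (h𝒳 : IsQuasiProjectiveOver 𝒳)
    (hB : IsQuasiProjectiveOver B) (hBsm : AlgebraicGeometry.Smooth B.hom) [IrreducibleSpace B.left]
    (σ : ComplexPoints B → FiberClass g (2 * p)) (hσ : Continuous σ) (hpt : ∀ b, (σ b).pt = b)
    (hHC : ∀ᶠ b in residual (ComplexPoints B), HodgeConjectureFor n (fiberOver g b))
    (hrat : ∀ᶠ b in residual (ComplexPoints B), IsRationalClass ((σ b).clsAt (hpt b)))
    (htyp : ∀ᶠ b in residual (ComplexPoints B),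
      IsOfHodgeType n (fiberOver g b) (2 * p) p p ((σ b).clsAt (hpt b)))
    (b : ComplexPoints B) :
    (σ b).clsAt (hpt b) ∈ algebraicClasses (fiberOver g b) p := by
  refine forall_cls_mem_algebraicClasses_of_residual_of_section g hg h𝒳 hB hBsm σ hσ hpt ?_ b
  filter_upwards [hHC, hrat, htyp] with b' hHC' hrat' htyp'
  exact hHC'.2 p _ hrat' htyp'

end Summit.HodgeConjecture.HodgeConjecture.Theorems.MarkmanPartnerTransport.VeryGeneralSpread

end
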